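import Literature.Analysis.OperatorTheory.TempleCertificate
import HarnessLib

/-!
# The Temple certificate in RESIDUAL form (Reed–Simon IV, Thm. XIII.5; Kato VI §4 / Davis–Kahan)

Topic `Analysis/OperatorTheory`; theorems only.  `TempleCertificate.lean` packages Temple's lower bound and Kato's
eigenvector enclosure for certified numerics in terms of ENCLOSURES `ρ ∈ [ρlo, ρhi]` of the Rayleigh quotient and a bound
`‖Tx‖² ≤ α` of the image norm; the quality of the trial then enters as `α - ρhi²`, into which the WIDTH of the Rayleigh
enclosure enters at first order (`α - ρhi² ≥ ‖(T - ρ)x‖² + 2|ρhi|(ρhi - ρlo)`-type losses).  For a sharply resolved trial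
(true residual far below the certified widths) the right currency is the RESIDUAL: a bound `‖T x - s x‖² ≤ et` for SOME
shift `s` (any real number; `et ≥ ‖(T - ρ)x‖²` automatically, `ρ = Re⟪x,Tx⟫` being the minimising shift).  This file derives
that form as a corollary of `temple_certificate`:

* `templeR_bound_ge_min` — the residual certificate function `g(ρ) = (βρ - ρ² - et)/(β - ρ) = ρ - et/(β - ρ)` takes, on
  `[ρlo, ρhi] ⊂ (-∞, β)`, a value `≥ min (g ρlo) (g ρhi)`;
* `temple_certificate_residual` — **the certificate**: bottom eigenvalue `l ≤ ρhi` with `min (g ρlo) (g ρhi) ≤ l`, Rayleigh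
  bound, spectral gap `β`, Kato's enclosure `‖x - v‖² ≤ et/(β - ρhi)²` of the trial by an `l`-eigenvector, and the
  multiplicity mass bound, [cite: ReedSimonIV1978, Thm. XIII.5].

## References
* M. Reed, B. Simon, *Methods of Modern Mathematical Physics IV: Analysis of Operators* (1978), Thm. XIII.5 [ReedSimonIV1978].
* T. Kato, *Perturbation Theory for Linear Operators* (1966), §VI.4 [Kato1966].
-/

noncomputable section

open scoped InnerProductSpace ComplexConjugate

namespace Literature.Analysis.OperatorTheory

variable {𝕜 : Type*} [RCLike 𝕜] {E : Type*} [NormedAddCommGroup E] [InnerProductSpace 𝕜 E]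

/-- **End-point bound for the residual Temple function.** For `ρ ∈ [ρlo, ρhi]`, `ρhi < β`:
`min g(ρlo) g(ρhi) ≤ g(ρ)` with `g(r) = (βr - r² - et)/(β - r) = r - et/(β - r)` (concave for `et ≥ 0`, convex otherwise;
either way an end point is below). [folklore] -/
theorem templeR_bound_ge_min {ρlo ρhi et β ρ : ℝ} (hlo : ρlo ≤ ρ) (hhi : ρ ≤ ρhi) (hβ : ρhi < β) :
    min ((β * ρlo - ρlo ^ 2 - et) / (β - ρlo)) ((β * ρhi - ρhi ^ 2 - et) / (β - ρhi)) ≤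
      (β * ρ - ρ ^ 2 - et) / (β - ρ) := by
  have key : ∀ r : ℝ, r < β → (β * r - r ^ 2 - et) / (β - r) = r - et / (β - r) := by
    intro r hr
    have : β - r ≠ 0 := by linarith
    field_simp
  have hρβ : ρ < β := lt_of_le_of_lt hhi hβ
  have hloβ : ρlo < β := lt_of_le_of_lt hlo hρβ
  rw [key ρlo hloβ, key ρhi hβ, key ρ hρβ]
  have h1 : 0 < β - ρ := by linarith
  have h2 : 0 < β - ρlo := by linarith
  have h3 : 0 < β - ρhi := by linarith
  -- `g ρ - g ρlo = (ρ - ρlo) (1 - et/((β-ρ)(β-ρlo)))`, `g ρ - g ρhi = (ρhi - ρ) (et/((β-ρ)(β-ρhi)) - 1)`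
  rcases le_or_gt et ((β - ρ) * (β - ρlo)) with hcase | hcase
  · refine (min_le_left _ _).trans ?_
    have hdiff : et / (β - ρ) - et / (β - ρlo) = et * (ρ - ρlo) / ((β - ρ) * (β - ρlo)) := by
      field_simp
      ring
    have : et / (β - ρ) - et / (β - ρlo) ≤ ρ - ρlo := by
      rw [hdiff, div_le_iff₀ (mul_pos h1 h2)]
      nlinarith
    linarith
  · refine (min_le_right _ _).trans ?_
    have hlt : (β - ρ) * (β - ρhi) < et := lt_of_le_of_lt (by nlinarith) hcase
    have hdiff : et / (β - ρhi) - et / (β - ρ) = et * (ρhi - ρ) / ((β - ρ) * (β - ρhi)) := by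
      field_simp
      ring
    have : ρhi - ρ ≤ et / (β - ρhi) - et / (β - ρ) := by
      rw [hdiff, le_div_iff₀ (mul_pos h1 h3)]
      nlinarith
    linarith

variable [CompleteSpace E]

/-- **The Temple certificate, residual form.** Let `T` be a compact self-adjoint operator on a Hilbert space; `d ≥ 1` a lower
bound for the multiplicity of its negative eigenvalues; `h` a bound for the negative square mass over finite orthonormal
eigenfamilies; `x` a unit vector with `ρlo ≤ Re⟪x,Tx⟫ ≤ ρhi < 0` and RESIDUAL `‖Tx - s·x‖² ≤ et` for some real shift `s`;
`β ≤ 0` with `h - d ρhi² ≤ β²` and `ρhi < β`.  Then the bottom of the spectrum is an eigenvalue `l ≤ ρhi`, every `y`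
satisfies `l ‖y‖² ≤ Re⟪y,Ty⟫`, every eigenvalue other than `l` is `≥ β`,
`min ((βρlo - ρlo² - et)/(β - ρlo)) ((βρhi - ρhi² - et)/(β - ρhi)) ≤ l` (Temple with the residual: `‖(T-ρ)x‖² ≤ ‖(T-s)x‖²`,
`ρ = Re⟪x,Tx⟫` minimising the shifted residual; concavity in `ρ`), `x` is within `√(et/(β - ρhi)²)` of an `l`-eigenvector
(Kato / Davis–Kahan), and an orthonormal `m`-family of `l`-eigenvectors forces `m ρhi² ≤ h`.
[cite: ReedSimonIV1978, Thm. XIII.5] -/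
theorem temple_certificate_residual {T : E →L[𝕜] E} (hT : IsCompactOperator T) (hsa : IsSelfAdjoint T)
    {d : ℕ} (hd : 1 ≤ d)
    (hmult : ∀ (c : ℝ) (v : E), c < 0 → v ≠ 0 → T v = (c : 𝕜) • v →
      ∃ w : Fin d → E, Orthonormal 𝕜 w ∧ ∀ j, T (w j) = (c : 𝕜) • w j)
    {h : ℝ} (hsq : ∀ (m : ℕ) (w : Fin m → E) (c : Fin m → ℝ), Orthonormal 𝕜 w →
      (∀ j, c j < 0 ∧ T (w j) = (c j : 𝕜) • w j) → ∑ j, c j ^ 2 ≤ h)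
    {x : E} (hx : ‖x‖ = 1) {ρlo ρhi et β s : ℝ}
    (hρlo : ρlo ≤ RCLike.re ⟪x, T x⟫_𝕜) (hρhi : RCLike.re ⟪x, T x⟫_𝕜 ≤ ρhi) (hρhi0 : ρhi < 0)
    (hres : ‖T x - (s : 𝕜) • x‖ ^ 2 ≤ et) (hβ0 : β ≤ 0) (hβ : h - d * ρhi ^ 2 ≤ β ^ 2) (hρβ : ρhi < β) :
    ∃ l : ℝ, (∃ v : E, v ≠ 0 ∧ T v = (l : 𝕜) • v) ∧ l ≤ ρhi ∧
      min ((β * ρlo - ρlo ^ 2 - et) / (β - ρlo)) ((β * ρhi - ρhi ^ 2 - et) / (β - ρhi)) ≤ l ∧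
      (∀ y : E, l * ‖y‖ ^ 2 ≤ RCLike.re ⟪y, T y⟫_𝕜) ∧
      (∀ (c : ℝ) (v : E), v ≠ 0 → T v = (c : 𝕜) • v → c = l ∨ β ≤ c) ∧
      (∃ v : E, T v = (l : 𝕜) • v ∧ ‖x - v‖ ^ 2 ≤ et / (β - ρhi) ^ 2) ∧
      (∀ (m : ℕ) (w : Fin m → E), Orthonormal 𝕜 w → (∀ j, T (w j) = (l : 𝕜) • w j) →
        (m : ℝ) * ρhi ^ 2 ≤ h) := by
  set ρ := RCLike.re ⟪x, T x⟫_𝕜 with hρdef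
  -- the residual controls `‖Tx‖² - ρ²`
  have hsym : ∀ u v : E, ⟪T u, v⟫_𝕜 = ⟪u, T v⟫_𝕜 := (ContinuousLinearMap.isSelfAdjoint_iff_isSymmetric.1 hsa)
  have hinner_re : RCLike.re ⟪T x, (s : 𝕜) • x⟫_𝕜 = s * ρ := by
    rw [inner_smul_right, hsym, RCLike.re_ofReal_mul]
  have hnorm_sx : ‖(s : 𝕜) • x‖ = |s| := by
    rw [norm_smul, hx, mul_one, RCLike.norm_ofReal]
  have hexp : ‖T x - (s : 𝕜) • x‖ ^ 2 = ‖T x‖ ^ 2 - 2 * (s * ρ) + s ^ 2 := by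
    rw [@norm_sub_sq 𝕜, hinner_re, hnorm_sx, sq_abs]
  have hα : ‖T x‖ ^ 2 ≤ ρ ^ 2 + et := by nlinarith [hexp, hres, sq_nonneg (ρ - s)]
  have het0 : 0 ≤ et := le_trans (sq_nonneg _) hres
  -- apply the `α`-form with the degenerate Rayleigh interval `[ρ, ρ]` and `α := ρ² + et`
  have hρ0 : ρ < 0 := lt_of_le_of_lt hρhi hρhi0
  have hρβ' : ρ < β := lt_of_le_of_lt hρhi hρβ
  have hρsq : ρhi ^ 2 ≤ ρ ^ 2 := by nlinarith
  have hβ' : h - d * ρ ^ 2 ≤ β ^ 2 := by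
    have hd0 : (0 : ℝ) ≤ d := by positivity
    nlinarith
  obtain ⟨l, hl, hlρ, hLl, hray, hgap, hkato, hmass⟩ :=
    temple_certificate hT hsa hd hmult hsq hx le_rfl le_rfl hρ0 hα hβ0 hβ' hρβ'
  refine ⟨l, hl, hlρ.trans hρhi, ?_, hray, hgap, ?_, ?_⟩
  · -- Temple in residual form, then concavity in `ρ`
    have h1 : (β * ρ - ρ ^ 2 - et) / (β - ρ) ≤ l := by
      have : min ((β * ρ - (ρ ^ 2 + et)) / (β - ρ)) ((β * ρ - (ρ ^ 2 + et)) / (β - ρ)) ≤ l := hLl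
      rw [min_self] at this
      simpa [sub_sub] using this
    exact (templeR_bound_ge_min hρlo hρhi hρβ).trans h1
  · -- Kato with the shift `ρ`, then `β - ρhi ≤ β - ρ`
    obtain ⟨v, hv, hxv⟩ := hkato
    refine ⟨v, hv, hxv.trans ?_⟩
    have hnum : ρ ^ 2 + et - ρ ^ 2 = et := by ring
    rw [hnum]
    have h3 : 0 < β - ρhi := by linarith
    exact div_le_div_of_nonneg_left het0 (pow_pos h3 2) (pow_le_pow_left₀ h3.le (by linarith) 2)
  · intro m w hw hTw
    exact le_trans (mul_le_mul_of_nonneg_left hρsq (Nat.cast_nonneg m)) (hmass m w hw hTw)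

end Literature.Analysis.OperatorTheory

end
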